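import Literature.NumberTheory.EllipticCurves.SerreOpenImageSupersingularInertiaProofs
import Literature.NumberTheory.EllipticCurves.SerreOpenImageThresholdProofs
import HarnessLib

/-!
# Serre's open image theorem over `ℚ` from the density fact and the tame Kummer character

Topic `NumberTheory/EllipticCurves`.  Theorems only (nothing is defined, no named fact).  This
file combines the supersingular analysis at the place's prime
(`isCyclic_and_card_inertia_map_of_dvd_frobeniusTrace`, `SerreOpenImageSupersingularInertiaProofs`:
Serre 1972, §1.11, Prop. 12 c) from the surjectivity of the tame Kummer character on inertia)
with the threshold assembly (`serre_open_image_of_supersingular_inertia_shape_from`,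
`SerreOpenImageThresholdProofs`):

* `map_inertia_smul_eq` — for a `Γ`-conjugate prime `g • 𝔓` the image of inertia under any
  homomorphism `ρ` is the conjugate subgroup: `ρ(I_{g𝔓}) = ρ(g) ρ(I_𝔓) ρ(g)⁻¹`, so "cyclic of
  order `m`" transports (`isCyclic_and_card_map_inertia_smul`);
* `serre_open_image_of_tame_kummer_surjective` — **the named fact `serre_open_image` (Serre 1972,
  §4.2, Théorème 2 over `ℚ`) follows from the density fact
  `WeierstrassCurve.serre_supersingular_density_zero` and the surjectivity of the tame character
  of level `ℓ² - 1` on the global inertia group at the place over every odd prime `ℓ`**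
  (§1.3, Prop. 1–2: `θ_d : I_t → μ_d` is onto, the Kummer extension `K_nr(ℓ^{1/d})/K_nr`
  being totally ramified): for `π ∈ ℚ̄` with `π^{ℓ²-1} = ℓ` and every `ζ` with `ζ^{ℓ²-1} = 1`
  some `s ∈ I_𝔓` has `s π = ζ π`.

## References

* [Serre1972] J.-P. Serre, Invent. Math. 15 (1972) 259–331, §1.3, §1.11 Prop. 12, §4.2 Thm. 2.
-/

noncomputable section

open scoped Classical NumberField Pointwise
open IsDedekindDomain Field

namespace Literature.NumberTheory.EllipticCurves

open _root_.WeierstrassCurve Rat.HeightOneSpectrum Literature.NumberTheory.GaloisRepresentations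

/-! ### Conjugate primes have conjugate images of inertia -/

section Conj

variable {B G M : Type*} [CommRing B] [Group G] [MulSemiringAction G B] [Group M]

/-- `I_{g • 𝔓} = g I_𝔓 g⁻¹` as an equality of subgroups (`Subgroup.map` along `MulAut.conj g`).
Neukirch, *Algebraic Number Theory*, Ch. I §9 (9.4). [folklore] -/
theorem inertia_smul_eq_map_conj' (g : G) (Q : Ideal B) :
    (g • Q).inertia G = (Q.inertia G).map (MulAut.conj g).toMonoidHom := by
  ext τ
  constructor
  · intro hτ
    refine ⟨g⁻¹ * τ * g, DegreeOnePrimes.conj_mem_inertia_of_mem_inertia_smul hτ, ?_⟩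
    rw [MulEquiv.coe_toMonoidHom, MulAut.conj_apply]
    group
  · rintro ⟨σ, hσ, rfl⟩
    rw [MulEquiv.coe_toMonoidHom, MulAut.conj_apply]
    have hσ' : σ ∈ (g⁻¹ • (g • Q)).inertia G := by rwa [inv_smul_smul]
    have := DegreeOnePrimes.conj_mem_inertia_of_mem_inertia_smul hσ'
    rwa [inv_inv] at this

/-- **The image of inertia at a conjugate prime is the conjugate subgroup**:
`ρ(I_{g𝔓}) = ρ(g) ρ(I_𝔓) ρ(g)⁻¹` for any group homomorphism `ρ`. [folklore] -/
theorem map_inertia_smul_eq (ρ : G →* M) (g : G) (Q : Ideal B) :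
    ((g • Q).inertia G).map ρ = ((Q.inertia G).map ρ).map (MulAut.conj (ρ g)).toMonoidHom := by
  rw [inertia_smul_eq_map_conj', Subgroup.map_map, Subgroup.map_map]
  congr 1
  ext σ
  simp [MulAut.conj_apply, map_mul, map_inv]

/-- Hence "the image of `I_𝔓` under `ρ` is cyclic of order `m`" holds for `g • 𝔓` as soon as it
holds for `𝔓`. [folklore] -/
theorem isCyclic_and_card_map_inertia_smul (ρ : G →* M) (g : G) (Q : Ideal B) {m : ℕ}
    (h : IsCyclic ((Q.inertia G).map ρ) ∧ Nat.card ((Q.inertia G).map ρ) = m) :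
    IsCyclic (((g • Q).inertia G).map ρ) ∧ Nat.card (((g • Q).inertia G).map ρ) = m := by
  obtain ⟨hcyc, hcard⟩ := h
  have hinj : Function.Injective (MulAut.conj (ρ g)).toMonoidHom := (MulAut.conj (ρ g)).injective
  set e := ((Q.inertia G).map ρ).equivMapOfInjective _ hinj
  rw [map_inertia_smul_eq]
  haveI := hcyc
  exact ⟨isCyclic_of_surjective e e.surjective, by rw [← hcard]; exact (Nat.card_congr e.toEquiv).symm⟩

end Conj

/-! ### The assembly -/

/-- **Serre 1972, §4.2, Théorème 2 over `ℚ` (`serre_open_image`) from the density fact and the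
surjectivity of the tame Kummer character on inertia.**  Assume
(hD) `WeierstrassCurve.serre_supersingular_density_zero` (for `E/ℚ` without CM the good
supersingular primes have density `0`; Serre 1968 IV-13 / 1981 §8), and (hT) for every odd
prime `ℓ`, the prime `𝔓` of `\bar ℤ` cut out by the place `placeOver ℓ`
(`x ∈ 𝔓 ↔ x ∈ 𝒪_𝔓.nonunits`), every `π ∈ ℚ̄` with `π^{ℓ²-1} = ℓ` and every `(ℓ² - 1)`-th root of
unity `ζ`, an element `s` of the inertia group `I_𝔓 ≤ Γ_ℚ` with `s π = ζ π` (Serre 1972, §1.3,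
Prop. 1–2: the character `θ_{ℓ²-1}` of the tame inertia is onto `μ_{ℓ²-1}`).  Then for every
elliptic curve `E/ℚ` without complex multiplication `ρ̄_{E,ℓ} : Γ_ℚ → GL₂(𝔽_ℓ)` is surjective for
all large `ℓ`.  Proof: `serre_open_image_of_supersingular_inertia_shape_from` with the
supersingular input at `ℓ ≥ 3` supplied by `isCyclic_and_card_inertia_map_of_dvd_frobeniusTrace`
at the place's prime and transported to every prime above `ℓ` by conjugation
(`HeightOneSpectrum.exists_smul_eq_of_mem_primesAbove_holds`, `isCyclic_and_card_map_inertia_smul`).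
[cite: Serre1972, §4.2 Théorème 2; §1.11 Prop. 12; §1.3 Prop. 1–2] -/
theorem serre_open_image_of_tame_kummer_surjective (hD : serre_supersingular_density_zero)
    (hT : ∀ (ℓ : ℕ) [Fact ℓ.Prime], ℓ ≠ 2 → ∀ 𝔓 : Ideal (absIntegers (𝓞 ℚ) ℚ),
      (∀ x : absIntegers (𝓞 ℚ) ℚ, x ∈ 𝔓 ↔ (x : AlgebraicClosure ℚ) ∈ (placeOver ℓ).nonunits) →
      ∀ π ζ : AlgebraicClosure ℚ, π ^ (ℓ ^ 2 - 1) = ℓ → ζ ^ (ℓ ^ 2 - 1) = 1 →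
        ∃ s ∈ 𝔓.inertia (absoluteGaloisGroup ℚ), s • π = ζ * π) :
    serre_open_image := by
  refine serre_open_image_of_supersingular_inertia_shape_from hD fun W _ _ ↦ ⟨3, ?_⟩
  intro ℓ _ h3 hgood hss v hv 𝔏 h𝔏
  have hℓ2 : ℓ ≠ 2 := by omega
  have hΔ := W.not_dvd_minimalDiscriminantInt_of_hasGoodReductionAtPrime' ℓ hgood
  obtain ⟨𝔓, hmem, h𝔓⟩ := exists_ideal_placeOver ℓ hv
  obtain ⟨g, hg⟩ :=
    HeightOneSpectrum.exists_smul_eq_of_mem_primesAbove_holds (K := ℚ) (v := v) h𝔓 h𝔏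
  rw [← hg]
  exact isCyclic_and_card_map_inertia_smul (galoisRepTorsion W ℓ) g 𝔓
    (isCyclic_and_card_inertia_map_of_dvd_frobeniusTrace ℓ hΔ hss hℓ2 hmem (hT ℓ hℓ2 𝔓 hmem))

end Literature.NumberTheory.EllipticCurves
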